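import Summits.AtomisticToContinuum.FouriersLaw.Theses.OddSectorIrreversibility
import Summits.AtomisticToContinuum.FouriersLaw.Theorems.OddSectorIrreversibilityCorrectorTheoryLeakFixedTime
import Summits.AtomisticToContinuum.FouriersLaw.Theorems.OddSectorIrreversibilityCorrectorTheoryEnergy

/-!
# `CorrectorTheory` (stmt-AtomisticToContinuum-14071): the leak identity, conjunct A, and the reduction to the Green–Kubo conjunct

Support item `stmt-AtomisticToContinuum-14071` of route `OddSectorIrreversibility` is
`CorrectorTheory = (A: the fixed-N corrector calculus) ∧ (B: the open-chain Green–Kubo identity)`,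
conjunct B being `StaticAbelianSqueeze.KuboAbelIdentity` (item stmt-AtomisticToContinuum-13419) verbatim.

* `integral_mul_setIntegral_liouvilleOp_currentFlow`, `leak_identity` — **clause (7), the leak
  identity**: for `P = pinnedChain ω₂ lam β γ`, `T > 0`, `μ_T = e^{-H/T} dq dp`, a smooth `u ∈ L²(μ_T)`
  with `L u = -k` (`k ∈ L²` odd), every bond `i`, bath sites `b₀ = 0`, `b₁ = N-1`, `t ≥ 0`:
  `∫ u⁻ (j_i ∘ Φ_t) dμ_T - ∫ u⁻ j_i dμ_T
     = -γ T ∫_{(0,t]} (∫ ∂_{p_{b₀}} u⁺ ∂_{p_{b₀}}(j_i ∘ Φ_s) dμ_T + ∫ ∂_{p_{b₁}} u⁺ ∂_{p_{b₁}}(j_i ∘ Φ_s) dμ_T) ds`,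
  with `j_i ∘ Φ_s` written, as in the route file, as the integral of `j_i` against the ZERO-FRICTION
  transition kernel (a Dirac mass at the closed flow).  Proof: `j_i ∘ Φ_t - j_i = ∫₀ᵗ (X_H j_i) ∘ Φ_s ds`
  (part 7a), Fubini (domination by `|u⁻| C(1+H)³ e^{-H/T} ∈ L¹`), and `leak_pointwise` (part 7d′).
* `correctorCalculus` — **conjunct A, verbatim, proved**: for `ω₂, lam, β, γ > 0`, `T > 0` and every
  `N` there is a corrector `u` which is `C¹`, in `L²(μ_T)`, the `μ_T`-a.e. and `L²(μ_T)` limit of the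
  finite-horizon correctors `∫₀^τ P_t J dt`, with (5) the bond sum rule, (6) the tap energy identity,
  (7) the leak identity.  Assembly of `OddSectorIrreversibilityCorrectorTheory{Existence, Smooth, Energy,
  BondSum, DetFlow, TangentBound, TangentCurrent, LeakPointwise, LeakFixedTime}.lean`
  (`corrector_smooth` / `corrector_exists`, `bond_sum_rule`, `tap_energy_identity`, `leak_identity`);
  `N = 0` is degenerate (`J = 0`, `u = 0`).
* `CorrectorTheory_of_greenKubo` — the route decl follows from conjunct B alone (stated verbatim as the
  hypothesis; no other route's file is imported); `greenKubo_of_openChainGreenKubo`,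
  `CorrectorTheory_of_openChainGreenKubo` — likewise from `HonestZwanzig.OpenChainGreenKubo`
  (stmt-AtomisticToContinuum-12696, verbatim).  Neither closes the item: both Green–Kubo items are open.

References: Kundu–Dhar–Narayan 2009 (reln1)–(reln3); CEHR 2018; folklore.
-/

noncomputable section

open MeasureTheory Filter Topology Set Function Metric
open scoped ContDiff NNReal ENNReal
open Literature.MathematicalPhysics.KineticTheory.HeatConduction
open Literature.MathematicalPhysics.KineticTheory
open Summit.AtomisticToContinuum.FouriersLaw.Theorems.ClosedConeSensitivity.Negative.ZeroFrictionDictionary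
open Summit.AtomisticToContinuum.FouriersLaw.Theorems.ClosedConeSensitivity.Negative.TangentReduction
open Summit.AtomisticToContinuum.FouriersLaw.Theorems.SuperadditiveResistance.DeviceLiouville
open Summit.AtomisticToContinuum.FouriersLaw.Theorems.SuperadditiveResistance.Kubo
open Summit.AtomisticToContinuum.FouriersLaw.Theorems.LightConeBondHeat

namespace Summit.AtomisticToContinuum.FouriersLaw.Theorems.OddSectorIrreversibility.Corrector

variable {N : ℕ}

section LeakTime

variable {ω₂ lam β γ : ℝ} (hω : 0 < ω₂) (hl : 0 < lam) (hβ : 0 ≤ β) (hγ : 0 < γ) {T : ℝ} (hT : 0 < T)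
include hω hl hβ hT

/-- **Fubini for the leak integrand.** For `u⁻ ∈ L²(μ_T)` (any `v ∈ L²(μ_T)` continuous) and `t ≥ 0`:
`∫ v(x) (∫_{(0,t]} (X_H j_i)(Φ_s x) ds) ρ(x) dx = ∫_{(0,t]} ∫ v (X_H j_i)(Φ_s ·) ρ dx ds`
(domination by `|v| C (1+H)³ ρ ∈ L¹`, joint measurability by continuity in each variable). [folklore] -/
theorem integral_mul_setIntegral_liouvilleOp_currentFlow (γ : ℝ) (N : ℕ) (i : Fin N) {v : PhaseSpace N → ℝ}
    (hvc : Continuous v) (hv2 : MemLp v 2 ((pinnedChain ω₂ lam β γ).gibbsMeasure N T)) (t : ℝ) :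
    ∫ x, v x * (∫ s in Ioc (0 : ℝ) t, liouvilleOp (pinnedChain ω₂ lam β γ) N
        (fun y => (pinnedChain ω₂ lam β γ).bondCurrent N i y) (detFlow ω₂ lam β N s x)) *
          (pinnedChain ω₂ lam β γ).gibbsDensity N T x =
      ∫ s in Ioc (0 : ℝ) t, ∫ x, v x * liouvilleOp (pinnedChain ω₂ lam β γ) N
        (fun y => (pinnedChain ω₂ lam β γ).bondCurrent N i y) (detFlow ω₂ lam β N s x) *
          (pinnedChain ω₂ lam β γ).gibbsDensity N T x := by
  set P := pinnedChain ω₂ lam β γ with hP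
  set ρ := P.gibbsDensity N T with hρ
  set X : PhaseSpace N → ℝ := liouvilleOp P N (fun y => P.bondCurrent N i y) with hX
  obtain ⟨C, hC0, hC⟩ := exists_abs_liouvilleOp_bondCurrent_le hω hl.le hβ γ N i
  have hU1 : ContDiff ℝ 1 P.U := pinnedChain_contDiff_U ω₂ lam β γ
  have hV1 : ContDiff ℝ 1 P.V := pinnedChain_contDiff_V ω₂ lam β γ
  have hj1 : ContDiff ℝ 1 fun y => P.bondCurrent N i y :=
    (contDiff_bondCurrent _ (pinnedChain_contDiff_V ω₂ lam β γ) N i).of_le (by norm_cast)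
  have hXc : Continuous X := continuous_liouvilleOp (P := P) hU1 hV1 hj1
  have hρc : Continuous ρ := pinnedChain_continuous_gibbsDensity ω₂ lam β γ N T
  have hρ0 : ∀ x, 0 ≤ ρ x := fun x => (Real.exp_pos _).le
  have hU0 : ∀ q, 0 ≤ P.U q := fun q => by show 0 ≤ ω₂ * q ^ 2 / 2 + lam * q ^ 4 / 4; positivity
  have hV0 : ∀ r, 0 ≤ P.V r := fun r => by show 0 ≤ r ^ 2 / 2 + β * r ^ 4 / 4; positivity
  -- the integrand on `(0,t] × Ω` and its majorant
  set F : ℝ → PhaseSpace N → ℝ := fun s x => v x * X (detFlow ω₂ lam β N s x) * ρ x with hF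
  have hFm : Measurable (uncurry F) :=
    measurable_uncurry_of_continuous_of_measurable
      (fun x => (continuous_const.mul (hXc.comp (continuous_detFlow_time hω hl.le hβ N x))).mul
        continuous_const)
      (fun s => ((hvc.mul (hXc.comp (continuous_detFlow hω hl.le hβ N s))).mul hρc).measurable)
  have hcube : MemLp (fun x => C * (1 + P.hamiltonian N x) ^ 3) 2 (P.gibbsMeasure N T) := by
    refine memLp_two_of_abs_le_cube hω hl hβ hT γ N
      (continuous_const.mul ((continuous_const.add (pinnedChain_continuous_hamiltonian ω₂ lam β γ N)).pow 3))
      hC0 fun y => ?_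
    have hH0 : 0 ≤ P.hamiltonian N y := P.hamiltonian_nonneg_of_nonneg hU0 hV0 N y
    rw [abs_of_nonneg (by positivity)]
  have hG : Integrable (fun x => |v x| * (C * (1 + P.hamiltonian N x) ^ 3) * ρ x) :=
    integrable_mul_mul_gibbsDensity hω hl.le hβ γ N hT hv2.abs hcube
  have hInt : Integrable (uncurry F) ((volume.restrict (Ioc (0 : ℝ) t)).prod volume) := by
    refine Integrable.mono' ((integrable_const (1 : ℝ)).mul_prod hG) hFm.aestronglyMeasurable
      (Eventually.of_forall fun z => ?_)
    rcases z with ⟨s, x⟩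
    simp only [uncurry_apply_pair, hF, one_mul, Real.norm_eq_abs, abs_mul, abs_of_nonneg (hρ0 x)]
    refine mul_le_mul_of_nonneg_right (mul_le_mul_of_nonneg_left ?_ (abs_nonneg _)) (hρ0 x)
    have h := hC (detFlow ω₂ lam β N s x)
    rwa [hamiltonian_detFlow_all hω hl hβ γ N s] at h
  have hswap := integral_integral_swap hInt
  -- `∫ x, v (∫ X∘Φ_s ds) ρ = ∫ x, ∫ s, F s x`
  have e1 : (fun x => v x * (∫ s in Ioc (0 : ℝ) t, X (detFlow ω₂ lam β N s x)) * ρ x) =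
      fun x => ∫ s in Ioc (0 : ℝ) t, F s x := by
    funext x
    simp only [hF]
    rw [← integral_const_mul, ← integral_mul_const]
  rw [e1, ← hswap]

include hγ

/-- **The leak identity (conjunct A (7) of `CorrectorTheory`)** for a smooth `u ∈ L²(μ_T)` with
`L_{T,T} u = -k` (`k ∈ L²(μ_T)` odd in the momenta), every bond `i`, the bath sites `b₀ = 0`,
`b₁ = N - 1` and every `t ≥ 0`; `μ_T = e^{-H/T} dq dp`, `u^∓ = (u ∓ u∘Θ)/2`, and `j_i ∘ Φ_s` written as
the integral of `j_i` against the zero-friction transition kernel. [folklore] -/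
theorem leak_identity (N : ℕ) {u k : PhaseSpace N → ℝ} (hu : ContDiff ℝ ∞ u)
    (hu2 : MemLp u 2 ((pinnedChain ω₂ lam β γ).gibbsMeasure N T))
    (hk2 : MemLp k 2 ((pinnedChain ω₂ lam β γ).gibbsMeasure N T))
    (hkodd : ∀ x : PhaseSpace N, k (x.1, -x.2) = -k x)
    (hpde : ∀ x, (pinnedChain ω₂ lam β γ).generator N T T u x = -k x)
    (i b₀ b₁ : Fin N) {t : ℝ} (hb₀ : b₀.val = 0) (hb₁ : b₁.val = N - 1) (ht : 0 ≤ t) :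
    (∫ x, (u x - u (x.1, -x.2)) / 2 *
        (∫ y, (pinnedChain ω₂ lam β γ).bondCurrent N i y
          ∂((pinnedChain ω₂ lam β 0).transitionKernel N T T t.toNNReal x))
        ∂((volume : Measure (PhaseSpace N)).withDensity
          (fun x => ENNReal.ofReal (Real.exp (-((pinnedChain ω₂ lam β γ).hamiltonian N x) / T))))) -
      (∫ x, (u x - u (x.1, -x.2)) / 2 * (pinnedChain ω₂ lam β γ).bondCurrent N i x
        ∂((volume : Measure (PhaseSpace N)).withDensity
          (fun x => ENNReal.ofReal (Real.exp (-((pinnedChain ω₂ lam β γ).hamiltonian N x) / T))))) =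
    -(γ * T) * ∫ s in Ioc (0 : ℝ) t,
      ((∫ x, partialP b₀ (fun x : PhaseSpace N => (u x + u (x.1, -x.2)) / 2) x *
          partialP b₀ (fun x : PhaseSpace N => ∫ y, (pinnedChain ω₂ lam β γ).bondCurrent N i y
            ∂((pinnedChain ω₂ lam β 0).transitionKernel N T T s.toNNReal x)) x
          ∂((volume : Measure (PhaseSpace N)).withDensity
            (fun x => ENNReal.ofReal (Real.exp (-((pinnedChain ω₂ lam β γ).hamiltonian N x) / T))))) +
        ∫ x, partialP b₁ (fun x : PhaseSpace N => (u x + u (x.1, -x.2)) / 2) x *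
          partialP b₁ (fun x : PhaseSpace N => ∫ y, (pinnedChain ω₂ lam β γ).bondCurrent N i y
            ∂((pinnedChain ω₂ lam β 0).transitionKernel N T T s.toNNReal x)) x
          ∂((volume : Measure (PhaseSpace N)).withDensity
            (fun x => ENNReal.ofReal (Real.exp (-((pinnedChain ω₂ lam β γ).hamiltonian N x) / T))))) := by
  have hUc : Continuous (pinnedChain ω₂ lam β γ).U := (pinnedChain_contDiff_U ω₂ lam β γ (n := 0)).continuous
  have hVc : Continuous (pinnedChain ω₂ lam β γ).V := (pinnedChain_contDiff_V ω₂ lam β γ (n := 0)).continuous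
  -- the zero-friction kernel is the Dirac mass at the closed flow; `μ_T`-integrals are `ρ`-weighted
  have hker : ∀ (s : ℝ) (x : PhaseSpace N), ∫ y, (pinnedChain ω₂ lam β γ).bondCurrent N i y
      ∂((pinnedChain ω₂ lam β 0).transitionKernel N T T s.toNNReal x) =
        (pinnedChain ω₂ lam β γ).bondCurrent N i (detFlow ω₂ lam β N (s.toNNReal : ℝ) x) := fun s x =>
    integral_transitionKernel_zero_friction hω hl.le hβ N T T s.toNNReal x _
  simp only [hker, integral_withDensity_gibbs _ hUc hVc N T, Real.coe_toNNReal t ht]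
  set P := pinnedChain ω₂ lam β γ with hP
  set ρ := P.gibbsDensity N T with hρ
  set uo : PhaseSpace N → ℝ := fun y => (u y - u (y.1, -y.2)) / 2 with huo
  set ue : PhaseSpace N → ℝ := fun y => (u y + u (y.1, -y.2)) / 2 with hue
  set X : PhaseSpace N → ℝ := liouvilleOp P N (fun y => P.bondCurrent N i y) with hX
  -- replace `s.toNNReal` by `s` on `(0, t]`
  have hI : ∫ s in Ioc (0 : ℝ) t, ((∫ x, partialP b₀ ue x *
      partialP b₀ (fun x => P.bondCurrent N i (detFlow ω₂ lam β N (s.toNNReal : ℝ) x)) x * ρ x) +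
        ∫ x, partialP b₁ ue x * partialP b₁ (fun x => P.bondCurrent N i (detFlow ω₂ lam β N (s.toNNReal : ℝ) x)) x * ρ x) =
      ∫ s in Ioc (0 : ℝ) t, ((∫ x, partialP b₀ ue x *
        partialP b₀ (fun x => P.bondCurrent N i (detFlow ω₂ lam β N s x)) x * ρ x) +
          ∫ x, partialP b₁ ue x * partialP b₁ (fun x => P.bondCurrent N i (detFlow ω₂ lam β N s x)) x * ρ x) :=
    setIntegral_congr_fun measurableSet_Ioc fun s hs => by simp only [Real.coe_toNNReal s hs.1.le]
  -- smoothness, continuity, square integrability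
  have huos : ContDiff ℝ ∞ uo := contDiff_oddPart hu
  have hj1 : ContDiff ℝ 1 fun y => P.bondCurrent N i y :=
    (contDiff_bondCurrent _ (pinnedChain_contDiff_V ω₂ lam β γ) N i).of_le (by norm_cast)
  have huoc : Continuous uo := huos.continuous
  have huo2 : MemLp uo 2 (P.gibbsMeasure N T) := memLp_oddPart hu2
  have hj2 : MemLp (fun y => P.bondCurrent N i y) 2 (P.gibbsMeasure N T) := memLp_bondCurrent hω hl.le hβ hT γ i
  have hg2 : ∀ {s : ℝ}, 0 ≤ s → MemLp (fun x => P.bondCurrent N i (detFlow ω₂ lam β N s x)) 2 (P.gibbsMeasure N T) :=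
    fun hs => memLp_currentFlow hω hl hβ hT γ N i hs
  -- Step 1: the left-hand side as a double integral
  have hL : (∫ x, uo x * P.bondCurrent N i (detFlow ω₂ lam β N t x) * ρ x) -
      ∫ x, uo x * P.bondCurrent N i x * ρ x =
        ∫ s in Ioc (0 : ℝ) t, ∫ x, uo x * X (detFlow ω₂ lam β N s x) * ρ x := by
    rw [← integral_sub (integrable_mul_mul_gibbsDensity hω hl.le hβ γ N hT huo2 (hg2 ht))
      (integrable_mul_mul_gibbsDensity hω hl.le hβ γ N hT huo2 hj2),
      ← integral_mul_setIntegral_liouvilleOp_currentFlow hω hl hβ hT γ N i huoc huo2 t]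
    refine integral_congr_ae (Eventually.of_forall fun x => ?_)
    have h := comp_detFlow_sub_eq_integral hω hl.le hβ γ N hj1 ht x
    rw [intervalIntegral.integral_of_le ht] at h
    show uo x * P.bondCurrent N i (detFlow ω₂ lam β N t x) * ρ x - uo x * P.bondCurrent N i x * ρ x =
      uo x * (∫ s in Ioc (0 : ℝ) t, X (detFlow ω₂ lam β N s x)) * ρ x
    rw [← h]; ring
  -- Step 2: the fixed-time identity under the `s`-integral
  have hR : ∫ s in Ioc (0 : ℝ) t, ∫ x, uo x * X (detFlow ω₂ lam β N s x) * ρ x =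
      ∫ s in Ioc (0 : ℝ) t, -(γ * T) * ((∫ x, partialP b₀ ue x *
          partialP b₀ (fun x => P.bondCurrent N i (detFlow ω₂ lam β N s x)) x * ρ x) +
        ∫ x, partialP b₁ ue x * partialP b₁ (fun x => P.bondCurrent N i (detFlow ω₂ lam β N s x)) x * ρ x) := by
    refine setIntegral_congr_fun measurableSet_Ioc fun s hs => ?_
    have h := leak_pointwise hω hl hβ hγ hT N hu hu2 hk2 hkodd hpde i hs.1.le
    rw [h, sum_bathWeight_mul _ hb₀ hb₁]
  rw [hL, hR, integral_const_mul, hI]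

end LeakTime


/-- **Conjunct A of `CorrectorTheory` (the fixed-`N` corrector calculus), verbatim.** [folklore] -/
theorem correctorCalculus : (∀ ω₂ lam β γ : ℝ, 0 < ω₂ → 0 < lam → 0 < β → 0 < γ → ∀ T : ℝ, 0 < T → ∀ N : ℕ, let P := pinnedChain ω₂ lam β γ; let P₀ := pinnedChain ω₂ lam β 0; let μT : MeasureTheory.Measure (PhaseSpace N) := MeasureTheory.volume.withDensity (fun x : PhaseSpace N => ENNReal.ofReal (Real.exp (-(P.hamiltonian N x) / T))); let J : PhaseSpace N → ℝ := fun z => ∑ i : Fin N, P.bondCurrent N i z; ∃ u : PhaseSpace N → ℝ, ContDiff ℝ 1 u ∧ MeasureTheory.MemLp u 2 μT ∧ (∀ᵐ x ∂μT, Filter.Tendsto (fun τ : ℝ => ∫ t in Set.Ioc (0 : ℝ) τ, (∫ y, J y ∂(P.transitionKernel N T T t.toNNReal x))) Filter.atTop (nhds (u x))) ∧ Filter.Tendsto (fun τ : ℝ => ∫ x, ((∫ t in Set.Ioc (0 : ℝ) τ, (∫ y, J y ∂(P.transitionKernel N T T t.toNNReal x))) - u x) ^ 2 ∂μT) Filter.atTop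 (nhds 0) ∧ (∀ i i' : Fin N, i'.val = i.val + 1 → i'.val + 1 < N → ∫ x, u x * P.bondCurrent N i x ∂μT = ∫ x, u x * P.bondCurrent N i' x ∂μT) ∧ (∀ b₀ b₁ : Fin N, b₀.val = 0 → b₁.val = N - 1 → γ * T * ((∫ x, (partialP b₀ u x) ^ 2 ∂μT) + ∫ x, (partialP b₁ u x) ^ 2 ∂μT) = ∫ x, u x * J x ∂μT) ∧ (∀ (i b₀ b₁ : Fin N) (t : ℝ), b₀.val = 0 → b₁.val = N - 1 → 0 ≤ t → let uo : PhaseSpace N → ℝ := fun x => (u x - u (x.1, -x.2)) / 2; let ue : PhaseSpace N → ℝ := fun x => (u x + u (x.1, -x.2)) / 2; let jt : ℝ → PhaseSpace N → ℝ := fun s x => ∫ y, P.bondCurrent N i y ∂(P₀.transitionKernel N T T s.toNNReal x); (∫ x, uo x * jt t x ∂μT) - (∫ x, uo x * P.bondCurrent N i x ∂μT) = -(γ * T) * ∫ s in Set.Ioc (0 : ℝ) t, ((∫ x, partialP b₀ ue x * partialP b₀ (jt s) x ∂μT) + ∫ x, partialP b₁ ue x * partialP b₁ (jt s) x ∂μT)))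 := by
  intro ω₂ lam β γ hω hl hβ hγ T hT N P P₀ μT J
  rcases Nat.eq_zero_or_pos N with hN0 | hN
  · -- `N = 0`: no bonds, `J = 0`, `u = 0`
    subst hN0
    have hJ : J = fun _ => 0 := funext fun z => by
      show ∑ i : Fin 0, P.bondCurrent 0 i z = 0
      simp
    refine ⟨fun _ => 0, contDiff_const, MemLp.zero, ?_, ?_, fun i => i.elim0, fun b₀ => b₀.elim0,
      fun i => i.elim0⟩
    · refine Eventually.of_forall fun x => ?_
      simp only [hJ, integral_zero]
      exact tendsto_const_nhds
    · simp only [hJ, integral_zero, sub_zero]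
      norm_num
  · -- `N ≥ 1`
    obtain ⟨u, hus, hae, hpde, hgrowth⟩ := corrector_smooth hω hl hβ hγ hT hN
    have hϑ : 0 < 1 / (4 * T) := by positivity
    have h1ϑ : 1 / (4 * T) < 1 / T := by
      rw [div_lt_div_iff₀ (by positivity) hT]; nlinarith
    have h2ϑ : 2 * (1 / (4 * T)) < 1 / T := by
      rw [show 2 * (1 / (4 * T)) = 1 / (2 * T) by field_simp; ring, div_lt_div_iff₀ (by positivity) hT]
      nlinarith
    obtain ⟨K, c, -, -, -, -, -, -, hpt, hw2, hL2, -⟩ := corrector_exists hω hl hβ hγ hT hN hϑ h2ϑ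
      (fun s z => ∫ y, J y ∂(P.transitionKernel N T T s.toNNReal z)) rfl
      (fun z => ∫ s in Set.Ioi (0 : ℝ), ∫ y, J y ∂(P.transitionKernel N T T s.toNNReal z)) rfl
    have haeμ : (fun x => ∫ t in Set.Ioi (0 : ℝ), ∫ y, J y ∂(P.transitionKernel N T T t.toNNReal x)) =ᵐ[μT] u :=
      (withDensity_absolutelyContinuous _ _).ae_eq hae
    obtain ⟨K₁, -, huK⟩ := hgrowth (1 / (4 * T)) hϑ h1ϑ
    have hu2g : MemLp u 2 (P.gibbsMeasure N T) :=
      memLp_two_of_abs_le_exp hω hl.le hβ.le hT γ hus.continuous h2ϑ huK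
    obtain ⟨M, -, hJM⟩ := abs_totalBondCurrent_le_exp hω.le hl.le hβ.le γ N hϑ
    have hJc : Continuous J := continuous_totalBondCurrent ω₂ lam β γ N
    have hJ2 : MemLp J 2 (P.gibbsMeasure N T) := memLp_two_of_abs_le_exp hω hl.le hβ.le hT γ hJc h2ϑ hJM
    have hJodd : ∀ x : PhaseSpace N, J (x.1, -x.2) = -J x := fun x => totalBondCurrent_neg_momentum P N x
    have hu2 : ContDiff ℝ 2 u := hus.of_le (by norm_cast)
    refine ⟨u, hus.of_le (by norm_cast), hw2.ae_eq haeμ, ?_, ?_, ?_, ?_, ?_⟩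
    · filter_upwards [haeμ] with x hx
      rw [← hx]
      exact hpt x
    · refine hL2.congr fun τ => integral_congr_ae ?_
      filter_upwards [haeμ] with x hx
      rw [hx]
    · intro i i' hii' hint
      exact bond_sum_rule hω hl.le hβ.le hT hγ hu2 hu2g hJc hJ2 hJodd hpde hii' hint
    · intro b₀ b₁ hb₀ hb₁
      exact tap_energy_identity hω hl.le hβ.le hγ hT hu2 hu2g hJc hJ2 hpde hb₀ hb₁
    · intro i b₀ b₁ t hb₀ hb₁ ht
      exact leak_identity hω hl hβ.le hγ hT N hus hu2g hJ2 hJodd hpde i b₀ b₁ hb₀ hb₁ ht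

/-- **`CorrectorTheory` reduces to its second conjunct** (the open-chain Green–Kubo identity,
`StaticAbelianSqueeze.KuboAbelIdentity` = item stmt-AtomisticToContinuum-13419, stated here verbatim):
conjunct A is `correctorCalculus`. [folklore] -/
theorem CorrectorTheory_of_greenKubo
    (hK : ∀ ω₂ lam β γ : ℝ, 0 < ω₂ → 0 < lam → 0 < β → 0 < γ → let P := Literature.MathematicalPhysics.KineticTheory.HeatConduction.pinnedChain ω₂ lam β γ; (∀ (N : ℕ) (T_L T_R : ℝ), 0 < T_L → 0 < T_R → ∀ μ ν : MeasureTheory.Measure (Literature.MathematicalPhysics.KineticTheory.HeatConduction.PhaseSpace N), P.IsSteadyState N T_L T_R μ → P.IsSteadyState N T_L T_R ν → μ = ν) → ∀ μ : (N : ℕ) → ℝ → ℝ → MeasureTheory.Measure (Literature.MathematicalPhysics.KineticTheory.HeatConduction.PhaseSpace N), (∀ (N : ℕ) (T_L T_R : ℝ), 0 < T_L → 0 < T_R → P.IsSteadyState N T_L T_R (μ N T_L T_R)) → ∀ T : ℝ, 0 < T → ∀ (N : ℕ) (D : ℝ), Filter.Tendsto (fun δ : ℝ => P.totalCurrent (μ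 N (T + δ / 2) (T - δ / 2)) / δ) (nhdsWithin 0 {(0 : ℝ)}ᶜ) (nhds D) → let J : Literature.MathematicalPhysics.KineticTheory.HeatConduction.PhaseSpace N → ℝ := fun z => ∑ i : Fin N, P.bondCurrent N i z; MeasureTheory.IntegrableOn (fun t : ℝ => ∫ z, J z * (∫ y, J y ∂(P.transitionKernel N T T t.toNNReal z)) ∂(P.gibbsMeasure N T)) (Set.Ioi 0) ∧ ((N : ℝ) - 1) * T ^ 2 * D = ∫ t in Set.Ioi (0 : ℝ), ∫ z, J z * (∫ y, J y ∂(P.transitionKernel N T T t.toNNReal z)) ∂(P.gibbsMeasure N T)) :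
    Summit.AtomisticToContinuum.FouriersLaw.Theses.OddSectorIrreversibility.CorrectorTheory :=
  ⟨correctorCalculus, hK⟩

/-- **Conjunct B from `HonestZwanzig.OpenChainGreenKubo`** (item stmt-AtomisticToContinuum-12696, stated
verbatim as the hypothesis): that item asserts, for `N ≥ 2`, that the response quotient CONVERGES to
`∫₀^∞ corr(J,J)/((N-1)T²)`; by uniqueness of limits this identifies every response coefficient `D`,
and `corr(J,J)(t) = ∫ J P_tJ dμ_T` because `μ_T(J) = 0`; for `N ≤ 1` all bond currents vanish, so
`D = 0` and both sides are `0`. [folklore] -/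
theorem greenKubo_of_openChainGreenKubo
    (hG : ∀ ω₂ lam β γ : ℝ, 0 < ω₂ → 0 < lam → 0 < β → 0 < γ → (∀ (N : ℕ) (T_L T_R : ℝ), 0 < T_L → 0 < T_R → ∀ μ ν : MeasureTheory.Measure (Literature.MathematicalPhysics.KineticTheory.HeatConduction.PhaseSpace N), (Literature.MathematicalPhysics.KineticTheory.HeatConduction.pinnedChain ω₂ lam β γ).IsSteadyState N T_L T_R μ → (Literature.MathematicalPhysics.KineticTheory.HeatConduction.pinnedChain ω₂ lam β γ).IsSteadyState N T_L T_R ν → μ = ν) → ∀ μf : (N : ℕ) → ℝ → ℝ → MeasureTheory.Measure (Literature.MathematicalPhysics.KineticTheory.HeatConduction.PhaseSpace N), (∀ (N : ℕ) (T_L T_R : ℝ), 0 < T_L → 0 < T_R → (Literature.MathematicalPhysics.KineticTheory.HeatConduction.pinnedChain ω₂ lam β γ).IsSteadyState N T_L T_R (μf N T_L T_R)) → ∀ T : ℝ, 0 < T → ∀ N : ℕ, 2 ≤ N → let P := Literature.MathematicalPhysics.KineticTheory.HeatConduction.pinnedChain ω₂ lam β γ; let X := Literature.MathematicalPhysics.KineticTheory.HeatConduction.PhaseSpace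 N; let μ : MeasureTheory.Measure X := P.gibbsMeasure N T; let J : X → ℝ := fun z => ∑ i : Fin N, P.bondCurrent N i z; let corrJJ : ℝ → ℝ := fun t => (∫ z, J z * (∫ y, J y ∂(P.transitionKernel N T T t.toNNReal z)) ∂μ) - (∫ z, J z ∂μ) * (∫ z, J z ∂μ); MeasureTheory.IntegrableOn corrJJ (Set.Ioi 0) ∧ Filter.Tendsto (fun δ : ℝ => P.totalCurrent (μf N (T + δ / 2) (T - δ / 2)) / δ) (nhdsWithin 0 {(0 : ℝ)}ᶜ) (nhds ((∫ t in Set.Ioi (0 : ℝ), corrJJ t) / (((N : ℝ) - 1) * T ^ 2)))) :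
    ∀ ω₂ lam β γ : ℝ, 0 < ω₂ → 0 < lam → 0 < β → 0 < γ → let P := Literature.MathematicalPhysics.KineticTheory.HeatConduction.pinnedChain ω₂ lam β γ; (∀ (N : ℕ) (T_L T_R : ℝ), 0 < T_L → 0 < T_R → ∀ μ ν : MeasureTheory.Measure (Literature.MathematicalPhysics.KineticTheory.HeatConduction.PhaseSpace N), P.IsSteadyState N T_L T_R μ → P.IsSteadyState N T_L T_R ν → μ = ν) → ∀ μ : (N : ℕ) → ℝ → ℝ → MeasureTheory.Measure (Literature.MathematicalPhysics.KineticTheory.HeatConduction.PhaseSpace N), (∀ (N : ℕ) (T_L T_R : ℝ), 0 < T_L → 0 < T_R → P.IsSteadyState N T_L T_R (μ N T_L T_R)) → ∀ T : ℝ, 0 < T → ∀ (N : ℕ) (D : ℝ), Filter.Tendsto (fun δ : ℝ => P.totalCurrent (μ N (T + δ / 2) (T - δ / 2)) / δ) (nhdsWithin 0 {(0 : ℝ)}ᶜ) (nhds D) → let J : Literature.MathematicalPhysics.KineticTheory.HeatConduction.PhaseSpace N → ℝ := fun z => ∑ i : Fin N, P.bondCurrent N i z; MeasureTheory.IntegrableOn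 (fun t : ℝ => ∫ z, J z * (∫ y, J y ∂(P.transitionKernel N T T t.toNNReal z)) ∂(P.gibbsMeasure N T)) (Set.Ioi 0) ∧ ((N : ℝ) - 1) * T ^ 2 * D = ∫ t in Set.Ioi (0 : ℝ), ∫ z, J z * (∫ y, J y ∂(P.transitionKernel N T T t.toNNReal z)) ∂(P.gibbsMeasure N T) := by
  intro ω₂ lam β γ hω hl hβ hγ P hU μ hμ T hT N D hD J
  have hJ0 : ∫ z, J z ∂(P.gibbsMeasure N T) = 0 := integral_totalBondCurrent_gibbsMeasure ω₂ lam β γ N T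
  rcases lt_or_ge N 2 with hN | hN
  · -- `N ≤ 1`: no bonds
    have hj : ∀ (i : Fin N) (x : PhaseSpace N), P.bondCurrent N i x = 0 := fun i x => by
      show (pinnedChain ω₂ lam β γ).bondCurrent N i x = 0
      unfold OscillatorChain.bondCurrent
      refine Finset.sum_eq_zero fun j _ => ?_
      have hji : ¬ (j.val = i.val + 1) := by have := j.isLt; omega
      rw [if_neg hji]
    have hJ : J = fun _ => 0 := funext fun z => by
      show ∑ i : Fin N, P.bondCurrent N i z = 0
      exact Finset.sum_eq_zero fun i _ => hj i z
    have h0 : Tendsto (fun δ : ℝ => P.totalCurrent (μ N (T + δ / 2) (T - δ / 2)) / δ) (𝓝[≠] 0) (𝓝 0) := by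
      have e : (fun δ : ℝ => P.totalCurrent (μ N (T + δ / 2) (T - δ / 2)) / δ) = fun _ => 0 := funext fun δ => by
        have : P.totalCurrent (μ N (T + δ / 2) (T - δ / 2)) = 0 := by
          show ∑ i : Fin N, ∫ x, P.bondCurrent N i x ∂(μ N (T + δ / 2) (T - δ / 2)) = 0
          exact Finset.sum_eq_zero fun i _ => by simp only [hj, integral_zero]
        rw [this, zero_div]
      rw [e]; exact tendsto_const_nhds
    have hD0 : D = 0 := tendsto_nhds_unique hD h0
    refine ⟨?_, ?_⟩
    · simp only [hJ, zero_mul, integral_zero]; exact integrableOn_zero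
    · simp only [hJ, integral_zero, hD0, mul_zero]
  · -- `N ≥ 2`
    obtain ⟨h1, h2⟩ := hG ω₂ lam β γ hω hl hβ hγ hU μ hμ T hT N hN
    have hJ0' : ∫ z, (∑ i : Fin N, (pinnedChain ω₂ lam β γ).bondCurrent N i z)
        ∂((pinnedChain ω₂ lam β γ).gibbsMeasure N T) = 0 := hJ0
    simp only [hJ0', mul_zero, sub_zero] at h1 h2
    have hDeq := tendsto_nhds_unique hD h2
    refine ⟨h1, ?_⟩
    have hne : ((N : ℝ) - 1) * T ^ 2 ≠ 0 := by
      have h2N : (2 : ℝ) ≤ N := by exact_mod_cast hN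
      exact mul_ne_zero (by linarith) (by positivity)
    have hcancel : ∀ X : ℝ, ((N : ℝ) - 1) * T ^ 2 * (X / (((N : ℝ) - 1) * T ^ 2)) = X := fun X =>
      mul_div_cancel₀ X hne
    rw [hDeq, hcancel]

/-- **`CorrectorTheory` from `HonestZwanzig.OpenChainGreenKubo`** (item stmt-AtomisticToContinuum-12696, verbatim as
the hypothesis): a second closing path for the item. [folklore] -/
theorem CorrectorTheory_of_openChainGreenKubo
    (hG : ∀ ω₂ lam β γ : ℝ, 0 < ω₂ → 0 < lam → 0 < β → 0 < γ → (∀ (N : ℕ) (T_L T_R : ℝ), 0 < T_L → 0 < T_R → ∀ μ ν : MeasureTheory.Measure (Literature.MathematicalPhysics.KineticTheory.HeatConduction.PhaseSpace N), (Literature.MathematicalPhysics.KineticTheory.HeatConduction.pinnedChain ω₂ lam β γ).IsSteadyState N T_L T_R μ → (Literature.MathematicalPhysics.KineticTheory.HeatConduction.pinnedChain ω₂ lam β γ).IsSteadyState N T_L T_R ν → μ = ν) → ∀ μf : (N : ℕ) → ℝ → ℝ → MeasureTheory.Measure (Literature.MathematicalPhysics.KineticTheory.HeatConduction.PhaseSpace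 N), (∀ (N : ℕ) (T_L T_R : ℝ), 0 < T_L → 0 < T_R → (Literature.MathematicalPhysics.KineticTheory.HeatConduction.pinnedChain ω₂ lam β γ).IsSteadyState N T_L T_R (μf N T_L T_R)) → ∀ T : ℝ, 0 < T → ∀ N : ℕ, 2 ≤ N → let P := Literature.MathematicalPhysics.KineticTheory.HeatConduction.pinnedChain ω₂ lam β γ; let X := Literature.MathematicalPhysics.KineticTheory.HeatConduction.PhaseSpace N; let μ : MeasureTheory.Measure X := P.gibbsMeasure N T; let J : X → ℝ := fun z => ∑ i : Fin N, P.bondCurrent N i z; let corrJJ : ℝ → ℝ := fun t => (∫ z, J z * (∫ y, J y ∂(P.transitionKernel N T T t.toNNReal z)) ∂μ) - (∫ z, J z ∂μ) * (∫ z, J z ∂μ); MeasureTheory.IntegrableOn corrJJ (Set.Ioi 0) ∧ Filter.Tendsto (fun δ : ℝ => P.totalCurrent (μf N (T + δ / 2) (T - δ / 2)) / δ) (nhdsWithin 0 {(0 : ℝ)}ᶜ) (nhds ((∫ t in Set.Ioi (0 : ℝ), corrJJ t) / (((N : ℝ) - 1) * T ^ 2)))) :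
    Summit.AtomisticToContinuum.FouriersLaw.Theses.OddSectorIrreversibility.CorrectorTheory :=
  ⟨correctorCalculus, greenKubo_of_openChainGreenKubo hG⟩

end Summit.AtomisticToContinuum.FouriersLaw.Theorems.OddSectorIrreversibility.Corrector

end
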